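import Literature.Computability.Complexity.InteractiveProofs
import Literature.Computability.Complexity.InstanceChecker
import HarnessLib

/-!
# Competitive interactive proofs (Bellare–Goldwasser)

Topic `Computability/Complexity`, namespace `Literature.Computability.Complexity`.

Bellare–Goldwasser's *competitive interactive proof systems* [BG94, Def. 4.2]: an interactive
proof system `(P, V)` for a language `L` — probabilistic polynomial-time verifier, completeness
`2/3`, soundness `1/3` against ALL (computationally unbounded) provers, exactly as for `IP` — whose
HONEST prover `P` "must run in probabilistic polynomial time given access to `L` as an oracle"
("the prover is allowed no more than the ability to decide the language himself"); the class
`compIP = {L : L has a competitive interactive proof system}` [BG94, §1.6]; and the two printed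
consequences connecting it with Blum–Kannan program checking (`InstanceChecker.lean`):

* **Lemma 4.3**, `compIP ⊆ frIP`: "Suppose `L` has a competitive interactive proof system. Then it
  has a decider." A *decider* for `L` [BG94, Def. 3.1] is a probabilistic polynomial-time oracle
  machine `D` with (1) `x ∈ L ⇒ D^L(x)` accepts with probability `≥ 2/3`, (2) `x ∉ L ⇒ D^A(x)`
  accepts with probability `≤ 1/3` for ALL oracles `A` — verbatim the verifier of a
  function-restricted proof system for `L`, i.e. `L ∈ frIP` ("`L` has a decider if and only if it
  is in function-restricted IP", BG94 §3; the tree's `mem_frIP_iff`). Proof as printed: `D` samples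
  coins for `P` and for `V`, runs both, and answers `P`'s oracle queries with its own oracle; with
  oracle `L` this is the honest interaction, with any oracle `A` it is an interaction of `V` with
  SOME prover, so soundness of `(P, V)` applies.
* **§5** (after Def. 5.1): "programs are history independent objects, while (cheating) provers
  are not. Thus, if `L` and `L̄` both have competitive interactive proofs then `L` has a checker"
  — DERIVED here (`instanceCheckable_of_mem_compIP`) from Lemma 4.3 twice and Blum–Kannan's
  `Check = frIP ∩ co-frIP` (the tree's named fact `instanceCheckable_iff`); only Lemma 4.3 is a
  named fact of this file.

## Rendering in the tree's model (what is, and is not, the printed wording)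

* Verifier and interaction are the tree's `IPVerifier` (Arora–Barak Def. 8.6, `InteractiveProofs.lean`:
  private coins `r ∈ {0,1}^{coins |x|}`, messages of length `msgLen |x|`, verifier speaks first,
  `IsPolyTime`), run for `|x|^c` messages (`c : ℕ`, also `c = 0`, unlike the tree's `IP` which
  takes `c ≥ 1` — harmless: pad with ignored rounds); soundness quantifies over every
  `IPProver` (an arbitrary strategy), which is BG94's clause (2) "for every interactive TM `P̂`"
  (unbounded provers are w.l.o.g. deterministic).
* The honest prover. BG94: a probabilistic polynomial-time ORACLE MACHINE with oracle `L`. Here: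
  a polynomial-time oracle function `M ∈ FPRel (Oracle.ofLanguage L)` (the tree's `FP^L`,
  `Oracle.lean`) applied to the prover's view `⟨x, ⟨s, enc (a₁, …, aᵢ)⟩⟩`, where
  `s ∈ {0,1}^{q |x|}` is the prover's random tape (a polynomial `q`; a probabilistic machine = a
  deterministic one reading a random tape, AB Def. 7.1), fixed during the interaction: given `s`
  its strategy is `competitiveStrategy M x s = (msgs ↦ M ⟨x, ⟨s, enc msgs⟩⟩)`. Completeness (1) is
  the probability over the verifier's AND the prover's coins, written with ONE uniform string
  `t = r ++ s` of length `coins |x| + q |x|` (`uniformProb`; uniform on the concatenation = product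
  of the two uniform distributions), `r = t.take (coins |x|)`, `s = t.drop (coins |x|)`.
* `q = 0` (empty prover tape) is a DETERMINISTIC honest prover `msgs ↦ M ⟨x, ⟨[], enc msgs⟩⟩`; up
  to the `FP` re-pairing `⟨x, enc msgs⟩ ↦ ⟨x, ⟨[], enc msgs⟩⟩` this is the honest-prover template
  `M ∈ FPRel (Oracle.ofLanguage SAT)`, `msgs ↦ M ⟨x, enc msgs⟩` of route `PneNP/UncheckableSAT`
  (there for `L = UNSAT` with a `SAT` oracle — `FP`-equivalent to an `UNSAT` oracle through the
  polynomial-time codeword test of `encodingCNF`; not carried out here).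
* Thresholds `2/3`, `1/3` verbatim (BG94 Def. 4.2, Def. 3.1, Def. 5.1).
* Not here: the PROOFS (Lemma 4.3 is one oracle-machine simulation in the `OracleAlg` model —
  named fact below); `compNP` / "search reduces to decision" (BG94 §2, §4.2) and
  `NP`-complete languages lying in `compNP ⊆ compIP` (self-reducibility); BG94 Thm. 4.4
  (`NEE ⊄ BPEE ⇒` some `L ∈ NP ∖ compIP`) and Thm. 5.3; coherence (§1.6, §5). Mathlib has no
  interactive proofs (searched `interactive proof`, `compIP`, `competitive`).

## References

* M. Bellare, S. Goldwasser, *The complexity of decision versus search*, SIAM J. Comput. 23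
  (1994) 97–119: §1.6 (the classes `compNP, IP, compIP, frIP, MIP, Check, Coh`; "compIP ⊆ frIP"),
  §3 Def. 3.1 (deciders; deciders = frIP), §4.2 Def. 4.2 (competitive interactive proofs),
  §4.3 Lemma 4.3 (`compIP ⊆ frIP`), Thm. 4.4, §5 Def. 5.1, Lemma 5.2, Thm. 5.3 (checking).
* M. Blum, S. Kannan, *Designing programs that check their work*, J. ACM 42 (1995), Thm. 7.1.
* S. Arora, B. Barak, *Computational Complexity: A Modern Approach*, CUP 2009, Def. 8.6, §8.6.
-/

namespace Literature.Computability.Complexity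

open _root_.Computability

/-! ### Competitive interactive proof systems (BG94 Def. 4.2) -/

/-- The strategy of the **honest competitive prover** `M` on input `x` with random tape `s`: the
messages so far `(a₁, …, aᵢ)` ↦ `M ⟨x, ⟨s, enc (a₁, …, aᵢ)⟩⟩` (list encoding as in
`IPVerifier.view`). BG94: the honest prover is a probabilistic polynomial-time oracle machine; `s`
is its random tape, `M` its (oracle) transition function in the tree's extensional style.
[cite: BellareGoldwasser1994, Def. 4.2] -/
def competitiveStrategy (M : List Bool → List Bool) (x s : List Bool) : IPProver :=
  fun msgs => M (boolPair x (boolPair s ((encodingList Bool).listBool.encode msgs)))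

/-- **`(M, V)` is a competitive interactive proof system for `L`** with `|x|^c` messages and
prover random tape of length `q |x|` (Bellare–Goldwasser Def. 4.2, module docstring): `V` is a
probabilistic polynomial-time verifier (`IPVerifier.IsPolyTime`); the honest prover `M` is
polynomial-time WITH ORACLE `L` (`M ∈ FP^L = FPRel (Oracle.ofLanguage L)`);
(1) completeness: for `x ∈ L`, over the verifier's coins `r ∈ {0,1}^{coins |x|}` and the prover's
coins `s ∈ {0,1}^{q |x|}` (one uniform string `t = r ++ s`), `V` accepts its interaction with the
honest strategy `competitiveStrategy M x s` with probability `≥ 2/3`;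
(2) soundness: for `x ∉ L` and EVERY prover strategy `P̂` (unrestricted), `V` accepts with
probability `≤ 1/3`. [cite: BellareGoldwasser1994, Def. 4.2] -/
def IsCompetitiveIP (V : IPVerifier) (c : ℕ) (M : List Bool → List Bool) (q : Polynomial ℕ)
    (L : Language Bool) : Prop :=
  V.IsPolyTime ∧ M ∈ FPRel (Oracle.ofLanguage L) ∧
    (∀ x ∈ L, (2 / 3 : ℝ) ≤
        uniformProb (V.coins.eval x.length + q.eval x.length)
          {t | V.Accepts (x.length ^ c) x (t.take (V.coins.eval x.length))
            (competitiveStrategy M x (t.drop (V.coins.eval x.length)))}) ∧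
      ∀ x ∉ L, ∀ P : IPProver, V.acceptProb (x.length ^ c) x P ≤ 1 / 3

/-- **`compIP = {L : L has a competitive interactive proof system}`** (BG94 §1.6): some
polynomial-time verifier, message-count exponent `c`, honest oracle prover `M ∈ FP^L` and prover
coin polynomial `q` form a competitive interactive proof system for `L`.
[cite: BellareGoldwasser1994, §1.6 and Def. 4.2] -/
def compIP : Set (Language Bool) :=
  {L | ∃ (V : IPVerifier) (c : ℕ) (M : List Bool → List Bool) (q : Polynomial ℕ),
    IsCompetitiveIP V c M q L}

/-! ### The printed consequences (one named fact, D-0014; one derived) -/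

/-- **Bellare–Goldwasser 1994, Lemma 4.3: `compIP ⊆ frIP`.** "Suppose `L` has a competitive
interactive proof system. Then it has a decider" — and deciders (Def. 3.1: probabilistic
polynomial-time oracle machines accepting `x ∈ L` with probability `≥ 2/3` under oracle `L`, and
`x ∉ L` with probability `≤ 1/3` under EVERY oracle) are exactly the verifiers of function-restricted
proof systems, `mem_frIP_iff` ("`L` has a decider if and only if it is in function-restricted IP",
BG94 §3). Printed proof: the decider samples coins for `P` and `V`, runs both, forwarding `P`'s
oracle queries to its own oracle; under oracle `L` this is the honest interaction, under any oracle
`A` an interaction of `V` with some prover. A named fact: the `OracleAlg` simulation is not carried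
out here. Grounds `Summit.PneNP.PneNP.Theses.UncheckableSAT.UncheckableOfNoCompetitiveIP`
(with `instanceCheckable_of_mem_compIP`). [cite: BellareGoldwasser1994, Lemma 4.3] -/
def compIP_subset_frIP : Prop :=
  compIP ⊆ frIP

/-- **Bellare–Goldwasser 1994, §5 (remark after Def. 5.1): "if `L` and `L̄` both have competitive
interactive proofs then `L` has a checker"** ("programs are history independent objects, while
(cheating) provers are not") — derived, as printed, from Lemma 4.3 (`compIP_subset_frIP`) for `L`
and for `Lᶜ` and Blum–Kannan's `Check = frIP ∩ co-frIP` (`instanceCheckable_iff`, BK95 Thm. 7.1,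
in its language form `instanceCheckable_iff.language`). Checkers as in BG94 Def. 5.1 = the tree's
`InstanceCheckable` (AB Def. 8.26 thresholds). [cite: BellareGoldwasser1994, §5 (after Def. 5.1)] -/
theorem instanceCheckable_of_mem_compIP (h₁ : compIP_subset_frIP) (h₂ : instanceCheckable_iff)
    {L : Language Bool} (hL : L ∈ compIP) (hLc : Lᶜ ∈ compIP) : InstanceCheckable L :=
  (instanceCheckable_iff.language h₂ L).2 ⟨h₁ hL, h₁ hLc⟩

/-! ### API -/

/-- Unfolding lemma for `compIP`. [cite: BellareGoldwasser1994, Def. 4.2] -/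
theorem mem_compIP_iff {L : Language Bool} :
    L ∈ compIP ↔ ∃ (V : IPVerifier) (c : ℕ) (M : List Bool → List Bool) (q : Polynomial ℕ),
      IsCompetitiveIP V c M q L :=
  Iff.rfl

/-- The honest competitive strategy answers the history `msgs` with `M`'s value on the prover's
view `⟨x, ⟨s, enc msgs⟩⟩`. [cite: BellareGoldwasser1994, Def. 4.2] -/
@[simp] theorem competitiveStrategy_apply (M : List Bool → List Bool) (x s : List Bool)
    (msgs : List (List Bool)) :
    competitiveStrategy M x s msgs =
      M (boolPair x (boolPair s ((encodingList Bool).listBool.encode msgs))) :=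
  rfl

/-- Soundness of a competitive interactive proof system is ordinary `IP` soundness: off `L` no
strategy is accepted with probability above `1/3`. [cite: BellareGoldwasser1994, Def. 4.2] -/
theorem IsCompetitiveIP.sound {V : IPVerifier} {c : ℕ} {M : List Bool → List Bool}
    {q : Polynomial ℕ} {L : Language Bool} (h : IsCompetitiveIP V c M q L) {x : List Bool}
    (hx : x ∉ L) (P : IPProver) : V.acceptProb (x.length ^ c) x P ≤ 1 / 3 :=
  h.2.2.2 x hx P

/-- The two printed facts combine to: if `UNSAT`-type languages `L`, `Lᶜ` have competitive
interactive proofs then `L` is checkable — the shape used by route PneNP/UncheckableSAT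
(contrapositive: "`SAT` has no instance checker" forces one of `SAT`, `SATᶜ` out of `compIP`).
[cite: BellareGoldwasser1994, §5 (after Def. 5.1)] -/
theorem not_mem_compIP_or_of_not_instanceCheckable (h₁ : compIP_subset_frIP)
    (h₂ : instanceCheckable_iff) {L : Language Bool} (hL : ¬ InstanceCheckable L) :
    L ∉ compIP ∨ Lᶜ ∉ compIP := by
  by_cases h1 : L ∈ compIP
  · exact Or.inr fun h2 => hL (instanceCheckable_of_mem_compIP h₁ h₂ h1 h2)
  · exact Or.inl h1

end Literature.Computability.Complexity
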